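import Mathlib
import Summits.KontsevichZagierPeriods.Zeta5Search.SecondOrderLive
import Summits.KontsevichZagierPeriods.Zeta5Search.DenomLaw.CentreCompanion
import Summits.KontsevichZagierPeriods.Zeta5Search.DenomLaw.ConjugateRaiseLawProof
import HarnessLib

/-!
# ζ(5) search — the `V`-HALF of the centre-companion identity IS A THEOREM (DENOM-LAW D1, prover-d1 gen 15)

HONEST FRAMING: systematic search; no irrationality claim unless certified.  Cell `pub-zeta5`, track «DENOM-LAW» D1, seat `denom-prover-d1`
gen 15 (`denom-law/prover-d1/ATTEMPT-15.md` §5, §9).  The `V`-components of both forms of the centre-companion identity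
(`DenomLaw.CentreCompanionOdd` / `CentreCompanionEven`, statement file `DenomLaw/CentreCompanion.lean`): under their hypotheses
`orbitV b p N x = orbitV b p N y`.  PROOF = typer g11's `SecondOrderLive.live_pair` (the raise lemma in pair form + the odd-centre class,
built for THEOREM A‴) read one level DEEPER: for the companion class `y` (type list `T ++ [1]`, a single raise of the palindrome `T`) Case A gives
`v̂_y + v̂_ȳ = τ_V(T)`; for the centre class `x` Case B (odd `b₀`: the odd-centre class of type `T`) resp. Case A (even `b₀`: its list
`raiseAtList T₀ (L/2)` is a single raise of `T₀`, and `x̄ = x`) gives `2v̂_x = τ_V(T)`; with `N` odd the orbit signs are `+1`, so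
`orbitV x = 2v̂_x = τ_V(T) = v̂_y + v̂_ȳ = orbitV y`.  The `𝒦`-half (`orbitK`) needs the `ĉ`-tools of `KDigitCentre` / `KDigitRaise` plus the
vanishing of the translation term `typeCCorr` on realised classes — not in this file.  Identities between explicit rationals; nothing here is
about ζ(5); no γ; records in print UNMOVED.
-/

noncomputable section

open Finset

namespace Summit.KontsevichZagierPeriods.Zeta5Search.DenomLaw

open Summit.KontsevichZagierPeriods.Zeta5Search.CasoratianValuation (InPolytope)
open Summit.KontsevichZagierPeriods.Zeta5Search.ClusterValuation
open Summit.KontsevichZagierPeriods.Zeta5Search.SecondOrder (classTypeList raiseAtList isRaise live_pair tTop tList typeTauV)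

variable {p : ℕ}

/-- `T ++ [1]` is a single raise of `T` (the new-end-point clause of `isRaise`). -/
theorem isRaise_append_one (T : List ℤ) : isRaise T (T ++ [1]) = true := by
  unfold isRaise; simp

/-- For `N` odd, `(−1)^{N+1} = 1` in `ℚ`. -/
theorem neg_one_pow_succ_of_odd {N : ℕ} (hN : ¬ 2 ∣ N) : (-1 : ℚ) ^ (N + 1) = 1 := by
  have hodd : Odd N := Nat.odd_iff.2 (by omega)
  exact hodd.add_one.neg_one_pow

/-- **`V`-half of `CentreCompanionOdd`**: under its hypotheses, `orbitV b p N x = orbitV b p N y`. -/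
theorem orbitV_centreCompanion_odd [hp : Fact p.Prime] (b : ℕ → ℤ) (N x y : ℕ) (Tc : List ℤ) (hb : InPolytope b)
    (hpb : (p : ℤ) ≤ b 0) (hodd : ¬ (2 : ℤ) ∣ b 0) (hN : ¬ 2 ∣ N) (hx : x < p) (hy : y < p)
    (hxpole : 2 ≤ classPoleCount b p x) (hxcen : CentreIn b p x) (hxE : classExp b p x = -(N : ℤ)) (hxT : classTypeList b p x = Tc)
    (hTc : Tc.reverse = Tc) (hypole : 2 ≤ classPoleCount b p y) (hycen : ¬ CentreIn b p y) (hyE : classExp b p y = -(N : ℤ))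
    (hyT : classTypeList b p y = Tc ++ [1]) :
    orbitV b p N x = orbitV b p N y := by
  have hpnN : p ≤ (b 0).toNat := by have := hb.1.1; omega
  have hxneg : classExp b p x < 0 := by rw [hxE]; omega
  have hyneg : classExp b p y < 0 := by rw [hyE]; omega
  -- the centre class: Case B of `live_pair`, with `x̄ = x`
  have hX := (live_pair b hb hpb hTc hx (by omega) hxneg (Or.inr ⟨hodd, hxcen, hxT⟩)).2
  rw [(centreIn_iff_conjClass_eq b hpnN hx).1 hxcen] at hX
  -- the companion pair: Case A of `live_pair`
  have hY := (live_pair b hb hpb hTc hy (by omega) hyneg (Or.inl (by rw [hyT]; exact isRaise_append_one Tc))).2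
  unfold orbitV
  rw [if_pos hxcen, if_neg hycen, neg_one_pow_succ_of_odd hN, one_mul, hY, ← hX]
  ring

/-- **`V`-half of `CentreCompanionEven`**: under its hypotheses, `orbitV b p N x = orbitV b p N y`. -/
theorem orbitV_centreCompanion_even [hp : Fact p.Prime] (b : ℕ → ℤ) (N x y L : ℕ) (T₀ : List ℤ) (hb : InPolytope b)
    (hpb : (p : ℤ) ≤ b 0) (hN : ¬ 2 ∣ N) (hx : x < p) (hy : y < p) (hlen : T₀.length = L + 1)
    (hT₀ : T₀.reverse = T₀) (hxpole : 2 ≤ classPoleCount b p x) (hxcen : CentreIn b p x) (hxE : classExp b p x = -(N : ℤ))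
    (hxT : classTypeList b p x = raiseAtList T₀ (L / 2)) (hypole : 2 ≤ classPoleCount b p y) (hycen : ¬ CentreIn b p y)
    (hyE : classExp b p y = -(N : ℤ)) (hyT : classTypeList b p y = T₀ ++ [1]) :
    orbitV b p N x = orbitV b p N y := by
  have hpnN : p ≤ (b 0).toNat := by have := hb.1.1; omega
  have hxneg : classExp b p x < 0 := by rw [hxE]; omega
  have hyneg : classExp b p y < 0 := by rw [hyE]; omega
  -- the centre class: Case A of `live_pair` (its list is a raise of `T₀` at the middle level), with `x̄ = x`
  have hX := (live_pair b hb hpb hT₀ hx (by omega) hxneg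
    (Or.inl (by rw [hxT]; exact isRaise_raiseAtList (by rw [hlen]; omega)))).2
  rw [(centreIn_iff_conjClass_eq b hpnN hx).1 hxcen] at hX
  -- the companion pair: Case A of `live_pair`
  have hY := (live_pair b hb hpb hT₀ hy (by omega) hyneg (Or.inl (by rw [hyT]; exact isRaise_append_one T₀))).2
  unfold orbitV
  rw [if_pos hxcen, if_neg hycen, neg_one_pow_succ_of_odd hN, one_mul, hY, ← hX]
  ring

end Summit.KontsevichZagierPeriods.Zeta5Search.DenomLaw

end
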